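import Literature.NumberTheory.GaloisRepresentations.ArtinConductorInductionProofs
import Literature.NumberTheory.Automorphic.ArtinLFunctionsBrauerCompletedReduction
import HarnessLib

/-!
# Brauer's factorisation of the completed Artin `L`-function (Neukirch VII, proof of (12.6)):
discharge of the named fact `brauer_completedArtinLFunction_eq_prod_zpow`

Topic `NumberTheory/Automorphic`; namespace `Literature.NumberTheory.Automorphic`.  The named fact
`brauer_completedArtinLFunction_eq_prod_zpow` (`ArtinLFunctionsFunctionalEquation`: every
completed Artin `L`-function is, on `re s > 1`, a finite product of integral powers of completed
`L`-functions of characters of degree one of finite extensions — Brauer's theorem (10.3) with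
(12.3) (i)–(iii)) was reduced in `ArtinLFunctionsBrauerCompletedReduction`
(`brauer_completedArtinLFunction_eq_prod_zpow_of_artinConductorNat`) to Neukirch VII (11.7) (iii)
in norm form for representations induced from characters of degree one.  That statement is now the
theorem `GaloisRepresentations.ArtinRep.artinConductorNat_eq_of_isInducedFrom`
(`GaloisRepresentations/ArtinConductorInductionProofs`, for induction from any Artin
representation), whence the discharge below.

## References

* J. Neukirch, *Algebraic Number Theory*, Grundlehren 322 (1999), VII (10.3), (11.7) (iii),
  (12.3), proof of (12.6) (p. 541). [NeukirchANT1999]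
* R. Brauer, On Artin's L-series with general group characters, Ann. of Math. 48 (1947), Thm. 1.
  [Brauer1947]
-/

noncomputable section

open scoped NumberField

namespace Literature.NumberTheory.Automorphic

universe u

variable {K : Type u} [Field K] [NumberField K]

/-- **Discharge of `brauer_completedArtinLFunction_eq_prod_zpow` (Neukirch VII, proof of (12.6):
"by Brauer's theorem … `Λ(L|K, χ, s) = ∏ᵢ Λ(Lᵢ|Kᵢ, χᵢ, s)^{nᵢ}`").**  The residual hypothesis of
`brauer_completedArtinLFunction_eq_prod_zpow_of_artinConductorNat` — (11.7) (iii) in norm form,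
`𝔑(𝔣(σ)) = 𝔑(𝔇_{M/K}) 𝔑(𝔣(π))` for `σ ≅ Ind_{Γ_M}^{Γ_K} π` with `π` of degree one — is the case
`dim π = 1` of `GaloisRepresentations.ArtinRep.artinConductorNat_eq_of_isInducedFrom`.
[cite: NeukirchANT1999, VII (12.6) proof, with (10.3), (11.7) (iii), (12.3)] [cite: Brauer1947, Thm. 1] -/
theorem brauer_completedArtinLFunction_eq_prod_zpow_holds :
    brauer_completedArtinLFunction_eq_prod_zpow (K := K) :=
  brauer_completedArtinLFunction_eq_prod_zpow_of_artinConductorNat fun M _ _ _ V' _ _ _ _ _ σ π h => by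
    have hn : Module.finrank ℂ (Fin 1 → ℂ) = 1 := Module.finrank_fin_fun ℂ
    have := GaloisRepresentations.ArtinRep.artinConductorNat_eq_of_isInducedFrom σ π.toArtinRep h
    rw [hn, pow_one] at this
    exact this

end Literature.NumberTheory.Automorphic
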